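import Mathlib
import HarnessLib
import Summits.CriticalPhenomena.CardyFormulaZ2.Theses.CardySelfRefinement
import Literature.Probability.RandomPlanarGeometry.ChordalReversibility
import Literature.Probability.RandomPlanarGeometry.ConformalRectangle
import Literature.Probability.RandomPlanarGeometry.IsometryCovariance
import Literature.Probability.RandomPlanarGeometry.TriangleDomain

/-!
# A Dobrushin domain with a DIAGONAL flat free arc: the triangle `(-1, 0, -i)`

Helper file for stub `stub_touchExponent` (S3) of line `SketchIdeatorTwo` of crux `SymmetryUpgradeR`
(stmt-CriticalPhenomena-17239, route CardySelfRefinement), stage T4a (geometry).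

The stub asks for two-sided `ε^{1/3}` touch bounds at SOME locally flat point of the free arc of
SOME Dobrushin domain. Ikhlef–Ponsaing's exact wall-passage probability pins the half-plane one-arm
exponent `1/3` of bond-`ℤ²` only for a wall of slope `±1` in lattice coordinates (the diagonal
strip), so the domain must present a DIAGONAL flat wall at the touch point, while its wired arc
should be axis-parallel (straight runs of boundary sites, wired by the boundary condition). The
open right isosceles triangle `Δ` with vertices `-1, 0, -i` does both:

* `Δ = {w | re w < 0, im w < 0, -1 < re w + im w}` (`touchExponent_triangleDomain`, carrier);
* marked points `a = pt 0 = -1`, `b = pt 1 = -i`; wired arc `arc 0 = [-1, 0] ∪ [0, -i]` (the two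
  axis-parallel legs), free arc `arc 1 = [-i, -1]` (the hypotenuse, slope `-1`);
* at the midpoint `z = -(1+i)/2` of the hypotenuse the domain is the half-disc
  `Δ ∩ B(z, 1/4) = {w ∈ B(z, 1/4) | 0 < im (conj u · (w - z))}` with the unit tangent
  `u = e^{-iπ/4} = (√2/2)(1 - i)`, i.e. `{re w + im w > -1}` — in lattice coordinates at mesh `δ`
  the diagonal half-plane `{v₀ + v₁ > -1/δ}` of `touchExponent_twoScaleArm`.

Built from the tree's `triangleDomain` (`Literature/Probability/RandomPlanarGeometry/TriangleDomain.lean`: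
carrier `interior (convexHull ℝ {a, b, c})`, perimeter loop `a → b → c → a` on thirds) with marks
`0, 2/3`; the carrier is identified through the barycentric coordinates of the affine basis
`(-1, 0, -i)` (`AffineBasis.interior_convexHull`), which are `(-re w, 1 + re w + im w, -im w)`.
-/

noncomputable section

namespace Summit.CriticalPhenomena.CardyFormulaZ2.Theorems.SymmetryUpgradeR.SwallowingSkeleton

open MeasureTheory Filter Set
open Literature.Probability.RandomPlanarGeometry Literature.Probability.LatticeModels
  Literature.Probability.Percolation
open UpperHalfPlane (upperHalfPlaneSet)
open Complex

/-! ### The affine basis `(-1, 0, -i)` and its barycentric coordinates -/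

/-- The triangle `-1, 0, -i` is non-degenerate. -/
theorem touchExponent_tri_affineIndependent : AffineIndependent ℝ ![(-1 : ℂ), 0, -I] := by
  rw [affineIndependent_iff_not_collinear_set]
  intro hcol
  rw [collinear_iff_of_mem (p₀ := (0 : ℂ)) (by simp)] at hcol
  obtain ⟨v, hv⟩ := hcol
  obtain ⟨r₁, hr₁⟩ := hv (-1) (by simp)
  obtain ⟨r₂, hr₂⟩ := hv (-I) (by simp)
  simp only [vadd_eq_add, add_zero] at hr₁ hr₂
  have h1 := congrArg Complex.re hr₁
  have h2 := congrArg Complex.im hr₁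
  have h3 := congrArg Complex.re hr₂
  have h4 := congrArg Complex.im hr₂
  simp only [smul_re, smul_im, smul_eq_mul, neg_re, one_re, neg_im, one_im, neg_zero, I_re,
    I_im] at h1 h2 h3 h4
  have : r₁ * v.im * (r₂ * v.re) = r₂ * v.im * (r₁ * v.re) := by ring
  rw [← h1, ← h2, ← h3, ← h4] at this
  linarith

/-- Barycentric coordinates of a point `w` in the basis `(-1, 0, -i)`:
`(-re w, 1 + re w + im w, -im w)`. -/
theorem touchExponent_tri_coord (w : ℂ) (k : Fin 3) :
    (triangleBasis (-1) 0 (-I) touchExponent_tri_affineIndependent).coord k w =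
      ![-w.re, 1 + w.re + w.im, -w.im] k := by
  set W : Fin 3 → ℝ := ![-w.re, 1 + w.re + w.im, -w.im] with hW
  have hsum : ∑ i, W i = 1 := by
    rw [Fin.sum_univ_three, hW]
    simp only [Matrix.cons_val_zero, Matrix.cons_val_one, Matrix.cons_val_two, Matrix.tail_cons,
      Matrix.head_cons]
    ring
  have hw : w = Finset.univ.affineCombination ℝ
      (triangleBasis (-1) 0 (-I) touchExponent_tri_affineIndependent) W := by
    rw [Finset.affineCombination_eq_linear_combination _ _ _ hsum, Fin.sum_univ_three,
      triangleBasis_apply_zero, triangleBasis_apply_one, triangleBasis_apply_two, hW]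
    simp only [Matrix.cons_val_zero, Matrix.cons_val_one, Matrix.cons_val_two, Matrix.tail_cons,
      Matrix.head_cons, smul_zero, add_zero]
    apply Complex.ext <;> simp
  conv_lhs => rw [hw]
  rw [AffineBasis.coord_apply_combination_of_mem _ (Finset.mem_univ k) hsum]

/-- The open triangle `-1, 0, -i` in coordinates. -/
theorem touchExponent_tri_interior :
    interior (convexHull ℝ {(-1 : ℂ), 0, -I}) = {w : ℂ | w.re < 0 ∧ w.im < 0 ∧ -1 < w.re + w.im} := by
  rw [← range_triangleBasis touchExponent_tri_affineIndependent, AffineBasis.interior_convexHull]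
  ext w
  simp only [mem_setOf_eq, touchExponent_tri_coord]
  constructor
  · intro h
    have h0 : 0 < -w.re := h 0
    have h1 : 0 < 1 + w.re + w.im := h 1
    have h2 : 0 < -w.im := h 2
    exact ⟨by linarith, by linarith, by linarith⟩
  · rintro ⟨h1, h2, h3⟩ k
    fin_cases k
    · show 0 < -w.re
      linarith
    · show 0 < 1 + w.re + w.im
      linarith
    · show 0 < -w.im
      linarith

/-! ### The perimeter loop on the three sides -/

/-- The loop on `[0, 2/3]` traces the two legs `[-1, 0] ∪ [0, -i]`. -/
theorem touchExponent_tri_image_legs :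
    triangleLoop (-1 : ℂ) 0 (-I) '' Icc (0 : ℝ) (2 / 3) =
      segment ℝ (-1 : ℂ) 0 ∪ segment ℝ (0 : ℂ) (-I) := by
  ext w
  simp only [mem_image, mem_Icc, mem_union]
  constructor
  · rintro ⟨t, ⟨ht0, ht1⟩, rfl⟩
    rw [triangleLoop_of_mem_Ico ⟨ht0, by linarith⟩]
    rcases le_or_gt t (1 / 3) with h | h
    · left
      rw [triangleLoopAux, if_pos h, segment_eq_image_lineMap]
      exact ⟨3 * t, ⟨by linarith, by linarith⟩, rfl⟩
    · right
      rw [triangleLoopAux, if_neg (not_le.2 h), if_pos ht1, segment_eq_image_lineMap]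
      exact ⟨3 * t - 1, ⟨by linarith, by linarith⟩, rfl⟩
  · rintro (h | h)
    · rw [segment_eq_image_lineMap] at h
      obtain ⟨θ, ⟨hθ0, hθ1⟩, rfl⟩ := h
      refine ⟨θ / 3, ⟨by linarith, by linarith⟩, ?_⟩
      rw [triangleLoop_of_mem_Ico ⟨by linarith, by linarith⟩, triangleLoopAux,
        if_pos (by linarith)]
      congr 1; ring
    · rw [segment_eq_image_lineMap] at h
      obtain ⟨θ, ⟨hθ0, hθ1⟩, rfl⟩ := h
      rcases eq_or_lt_of_le hθ0 with rfl | hθ0'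
      · refine ⟨1 / 3, ⟨by norm_num, by norm_num⟩, ?_⟩
        rw [triangleLoop_of_mem_Ico ⟨by norm_num, by norm_num⟩, triangleLoopAux_one_third]
        simp
      · refine ⟨(θ + 1) / 3, ⟨by linarith, by linarith⟩, ?_⟩
        rw [triangleLoop_of_mem_Ico ⟨by linarith, by linarith⟩, triangleLoopAux,
          if_neg (by linarith), if_pos (by linarith)]
        congr 1; ring

/-- The loop on `[2/3, 1]` traces the hypotenuse `[-i, -1]`. -/
theorem touchExponent_tri_image_hyp :
    triangleLoop (-1 : ℂ) 0 (-I) '' Icc (2 / 3 : ℝ) 1 = segment ℝ (-I) (-1 : ℂ) := by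
  ext w
  simp only [mem_image, mem_Icc]
  constructor
  · rintro ⟨t, ⟨ht0, ht1⟩, rfl⟩
    rcases eq_or_lt_of_le ht1 with rfl | ht1'
    · have : triangleLoop (-1 : ℂ) 0 (-I) 1 = -1 := by
        have h := periodic_triangleLoop (-1 : ℂ) 0 (-I) 0
        rw [zero_add] at h
        rw [h, triangleLoop_of_mem_Ico ⟨le_rfl, by norm_num⟩, triangleLoopAux_zero]
      rw [this]
      exact right_mem_segment _ _ _
    · rw [triangleLoop_of_mem_Ico ⟨by linarith, ht1'⟩]
      rcases eq_or_lt_of_le ht0 with rfl | ht0'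
      · rw [triangleLoopAux_two_thirds]; exact left_mem_segment _ _ _
      · rw [triangleLoopAux_of_two_thirds_lt ht0', segment_eq_image_lineMap]
        exact ⟨3 * t - 2, ⟨by linarith, by linarith⟩, rfl⟩
  · intro h
    rw [segment_eq_image_lineMap] at h
    obtain ⟨θ, ⟨hθ0, hθ1⟩, rfl⟩ := h
    rcases eq_or_lt_of_le hθ1 with rfl | hθ1'
    · refine ⟨1, ⟨by norm_num, le_rfl⟩, ?_⟩
      have h := periodic_triangleLoop (-1 : ℂ) 0 (-I) 0
      rw [zero_add] at h
      rw [h, triangleLoop_of_mem_Ico ⟨le_rfl, by norm_num⟩, triangleLoopAux_zero,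
        AffineMap.lineMap_apply_one]
    · rcases eq_or_lt_of_le hθ0 with rfl | hθ0'
      · refine ⟨2 / 3, ⟨le_rfl, by norm_num⟩, ?_⟩
        rw [triangleLoop_of_mem_Ico ⟨by norm_num, by norm_num⟩, triangleLoopAux_two_thirds,
          AffineMap.lineMap_apply_zero]
      · refine ⟨(θ + 2) / 3, ⟨by linarith, by linarith⟩, ?_⟩
        rw [triangleLoop_of_mem_Ico ⟨by linarith, by linarith⟩,
          triangleLoopAux_of_two_thirds_lt (by linarith)]
        congr 1; ring

/-! ### The registered helper -/

/-- **T4a `touchExponent_triangleDomain`** (registered helper for `stub_touchExponent`). There is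
a Dobrushin domain `(Δ; a, b)` whose carrier is the open right isosceles triangle
`{re < 0, im < 0, re + im > -1}`, with marked points `a = -1`, `b = -i`, wired arc
`arc 0 = [-1, 0] ∪ [0, -i]` (axis-parallel legs) and free arc `arc 1 = [-i, -1]` (the hypotenuse, a
DIAGONAL wall), and which near the midpoint `z = -(1+i)/2` of the hypotenuse is the flat half-disc
`Δ ∩ B(z, 1/4) = {w ∈ B(z, 1/4) | 0 < im (conj u (w - z))}`, `u = (√2/2)(1 - i)`. -/
theorem touchExponent_triangleDomain : ∃ D : DobrushinDomain, D.carrier = {w : ℂ | w.re < 0 ∧ w.im < 0 ∧ -1 < w.re + w.im} ∧ D.pt 0 = -1 ∧ D.pt 1 = -Complex.I ∧ D.arc 0 = segment ℝ (-1 : ℂ) 0 ∪ segment ℝ (0 : ℂ) (-Complex.I) ∧ D.arc 1 = segment ℝ (-Complex.I) (-1 : ℂ) ∧ D.carrier ∩ Metric.ball (-(1 + Complex.I) / 2) (1 / 4) = {w | w ∈ Metric.ball (-(1 + Complex.I) / 2) (1 / 4) ∧ 0 < ((starRingEnd ℂ) (⟨Real.sqrt 2 / 2, -(Real.sqrt 2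 / 2)⟩ : ℂ) * (w - -(1 + Complex.I) / 2)).im} := by
  set D : DobrushinDomain :=
    { toJordanDomain := triangleDomain (-1) 0 (-I) touchExponent_tri_affineIndependent
      mark := ![0, 2 / 3]
      strictMono_mark := by
        refine Fin.strictMono_iff_lt_succ.2 fun i => ?_
        fin_cases i; simp
      mark_mem := by
        intro i
        fin_cases i <;> norm_num } with hD
  have hcar : D.carrier = {w : ℂ | w.re < 0 ∧ w.im < 0 ∧ -1 < w.re + w.im} := by
    rw [hD]
    exact touchExponent_tri_interior
  have hm0 : D.mark 0 = 0 := rfl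
  have hm1 : D.mark 1 = 2 / 3 := rfl
  have hn0 : D.nextMark 0 = 2 / 3 := by simp [MarkedDomain.nextMark, hD]
  have hn1 : D.nextMark 1 = 1 := by simp [MarkedDomain.nextMark, hD]
  have hbd : D.boundary = triangleLoop (-1 : ℂ) 0 (-I) := rfl
  refine ⟨D, hcar, ?_, ?_, ?_, ?_, ?_⟩
  · show D.boundary (D.mark 0) = -1
    rw [hm0, hbd, triangleLoop_of_mem_Ico ⟨le_rfl, by norm_num⟩, triangleLoopAux_zero]
  · show D.boundary (D.mark 1) = -I
    rw [hm1, hbd, triangleLoop_of_mem_Ico ⟨by norm_num, by norm_num⟩, triangleLoopAux_two_thirds]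
  · show D.boundary '' Icc (D.mark 0) (D.nextMark 0) = _
    rw [hm0, hn0, hbd]
    exact touchExponent_tri_image_legs
  · show D.boundary '' Icc (D.mark 1) (D.nextMark 1) = _
    rw [hm1, hn1, hbd]
    exact touchExponent_tri_image_hyp
  · rw [hcar]
    ext w
    simp only [mem_inter_iff, mem_setOf_eq, Metric.mem_ball]
    have key : ((starRingEnd ℂ) (⟨Real.sqrt 2 / 2, -(Real.sqrt 2 / 2)⟩ : ℂ) *
        (w - -(1 + I) / 2)).im = Real.sqrt 2 / 2 * (w.re + w.im + 1) := by
      simp only [mul_im, conj_re, conj_im, sub_re, sub_im, neg_neg, div_ofNat_re, div_ofNat_im,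
        neg_re, neg_im, add_re, add_im, one_re, one_im, I_re, I_im]
      ring
    rw [key]
    have hs : (0 : ℝ) < Real.sqrt 2 / 2 := by positivity
    constructor
    · rintro ⟨⟨-, -, h3⟩, hb⟩
      exact ⟨hb, mul_pos hs (by linarith)⟩
    · rintro ⟨hb, hpos⟩
      have h3 : -1 < w.re + w.im := by
        have := (mul_pos_iff_of_pos_left hs).1 hpos
        linarith
      have hd : dist w (-(1 + I) / 2) < 1 / 4 := hb
      rw [Complex.dist_eq] at hd
      have hre : |(w - -(1 + I) / 2).re| < 1 / 4 := (abs_re_le_norm _).trans_lt hd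
      have him : |(w - -(1 + I) / 2).im| < 1 / 4 := (abs_im_le_norm _).trans_lt hd
      simp only [sub_re, sub_im, div_ofNat_re, div_ofNat_im, neg_re, neg_im, add_re, add_im,
        one_re, one_im, I_re, I_im] at hre him
      rw [abs_lt] at hre him
      norm_num at hre him
      exact ⟨⟨by linarith [hre.2], by linarith [him.2], h3⟩, hb⟩

end Summit.CriticalPhenomena.CardyFormulaZ2.Theorems.SymmetryUpgradeR.SwallowingSkeleton

end
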